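import Mathlib.Analysis.Calculus.FDeriv.Bilinear
import Mathlib.Analysis.Calculus.FDeriv.Mul
import Mathlib.Analysis.Calculus.Deriv.Mul
import Mathlib.Analysis.Calculus.Deriv.Comp
import Mathlib.Analysis.Calculus.Deriv.Add
import Mathlib.Analysis.Normed.Lp.PiLp
import HarnessLib

/-!
# K0⁷ STUB 1 (`stub_prop8StepCoP13`), sub-target S4b «the (δ∕δA′)V pieces at objects», brick 8:
# **SECT. F's `W = (δ∕δA′)V` IN THE (87)–(88) MULTIPLIER FORM ON COMPLEXIFIED CARRIERS** — the same four (88)-terms and the composed V₀-group, now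
# over `ℂ` with print's BILINEAR pairings (27)∕(66) and TRANSPOSES `Q*`, `𝔇*(A′)`, `H*` (displayed by their adjunction identities) instead of Euclidean
# adjoints: the Fréchet derivative over `ℂ` of `½⟨D, MD⟩ − ⟨QA′, MD⟩ + V₀(A′ − HD(A′))`, its (63)-certificate `⟨W(A′), δ⟩ = DV(A′)δ`, the HOLOMORPHY
# of `A′ ↦ W(A′)` (Prop. 4: «The functional derivative of V(A′) is an analytic function») and the pointwise (98)-slot from the printed letters — the
# currency of the route `UnitScaleTilt`'s Prop. 6 for (158) (`hWq`, `hWd` on `PBond P 0 → V`, `V` complex)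

Cell `pub-ymgap`, width seat `pub-ymgap-k0-s1-w2` g2 (director-ym №197 ∕ HUMAN RULING D-0149; plan g77–g81 W-SEAT-START-LIST §k0-s1, w2 ↦ S4b).
`--kind proof --supports stmt-QuantumFields-20541 --as helper`; count-neutral.  [15] = [Balaban1985Variational].

WHY.  Bricks 6–7 of this seat (`K0Stub1SectFHTermsMultiplierForm`, `K0Stub1SectFGradientAssembly`) type the `H`-groups of Sect. F's `V` ((157), (80) at
`J = 0`) in print's (87)–(88) multiplier form and assemble `W = (δ∕δA′)V` as a REAL gradient vector — the currency of k0-s1-w1's (128) ⟹ (158)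
(`K0Stub1Eq158FlatOpsAtRecord`).  The OTHER consumer, Prop. 6 for (158) at the record (k0-s1-w1 `K0Stub1FlatSmallSolution158AtRecord.existsUnique_smallSolution158_recordDom`,
UST `FlatSmallSolution158(Levels)`), wants `W` on COMPLEX fields `PBond (F.P K) 0 → V` (`V = 𝔤ᶜ`), HOLOMORPHIC on the (115)-ball (`hWd`), with the
pointwise (98)-slot there (`hWq`) — Prop. 4 p. 292: «the functional V(A′) on the space of configurations A′ with values in the complexified Lie algebra 𝔤ᶜ …
The functional derivative of V(A′) is an analytic function on this space».  On complex fields the pairing (27) `⟨A, J⟩ = Σ_b η^d tr A(b)J(b)` is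
BILINEAR, and print's `Q*`, `𝔇*(A′)`, `H*` are TRANSPOSES for it ((66) p. 287, (88), (90)).  THIS FILE is bricks 6–7's calculus over `ℂ` with bilinear
pairings: every transpose is a DISPLAYED LETTER given by its adjunction identity (`⟨Qᵗ X, δ⟩_E = ⟨X, Qδ⟩_F`, …), so nothing depends on a choice of carrier,
and the holomorphy clause `hWd` comes for free from the holomorphy of `D` and of `A′ ↦ 𝔇(A′)ᵗ`.

WHAT IS PROVED (sorry-free; no definition; axioms standard).  `E` (fine fields) and `F` (block data) complex normed spaces; `B : F →L[ℂ] F →L[ℂ] ℂ` and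
`BE : E →L[ℂ] E →L[ℂ] ℂ` continuous bilinear pairings, `B` symmetric; `M` `B`-symmetric (print's `(QGQ*)⁻¹ − a`); `Q : E →L[ℂ] F`; `D : E → F` with
derivative `𝔇` at `A′`; transposes `Qt`, `Dt`, `Ht` displayed by their adjunction identities.
* §1 ★ `hasFDerivAt_multiplierFormC` — (88) over `ℂ`: the derivative of `A ↦ ½B(D A, M D A) − B(QA, M D A)` at `A′` is `δ ↦ B(M(DA′ − QA′), 𝔇δ) − B(M DA′, Qδ)`;
  ★ `hasFDerivAt_multiplierFormC_pair` — the (63)∕(27) CERTIFICATE: that derivative IS `δ ↦ BE(W_H(A′), δ)` with `W_H(A′) = Dt(M(DA′ − QA′)) − Qt(M DA′)`.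
* §2 `hasFDerivAt_chart47C` (`T′ = 1 − H𝔇`), ★ `hasFDerivAt_comp_chart47C_pair` (the composed V₀-group: if `DΦ₀(TA′) = BE(g₀, ·)` then `D(Φ₀ ∘ T)(A′) =
  BE(g₀ − Dt(Ht g₀), ·)` — print's `(1 − 𝔇*(A′)H*)((δ∕δA)V₀)(A′ − HD(A′))`), ★★ `hasFDerivAt_sectF_VC_pair` (THE SUM: `DV(A′) = BE(W(A′), ·)` with
  `W(A′) = [Dt(M(DA′ − QA′)) − Qt(M DA′)] + [g₀ − Dt(Ht g₀)]`); `hasFDerivAt_of_line_certificate` (a (63)-certificate along lines + `ℂ`-differentiability ⇒ the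
  Fréchet form `DΦ₀ = BE(g₀, ·)` — the shape g0's V₀-current `exists_W_V0_flat` supplies).
* §3 ★ `differentiableOn_sectF_WC` — HOLOMORPHY (`hWd`): if `D`, `A ↦ 𝔇(A)ᵗ` (as a map into `F →L[ℂ] E`) and `A ↦ g₀(TA)` are `ℂ`-differentiable on a set, so is
  `A ↦ W(A)`.
* §4 (Pi carriers `ι → V`, `β → V′` — UST's `PBond P 0 → V` and block data —, pointwise weights): ★ `sectF_WC_slot98` — the (98)-slot of the whole `W(A′)` from the
  letters (3.132) `O₁` (for `M`), `q₀` (`Qt`), (73)ᵀ `θ` (`Dt A′`), (55) `C_Dr²`, the average `qr`, g0's `C_Vρ²` (the V₀-current at the chart point), (46)ᵀ `h₀` (`Ht`):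
  `w₃(b)‖W(A′)(b)‖ ≤ θO₁(C_Dr² + qr) + q₀O₁C_Dr² + (1 + θh₀)C_Vρ²`.
HONEST SCOPE.  Calculus and bookkeeping over displayed letters; the pairings, transposes, `M`, `Q`, `H`, `D`, `Φ₀`, `g₀` are PARAMETERS (at the record: the
bilinear (27)-pairing on `PBond (F.P K) 0 → M₂(ℂ)`, the componentwise extensions of `QE D`, `EE D − aE D w`, `hOp …` (UST `FlatScalarExtension`), the chart map of
UST `FlatChart47Levels`, pv27's `V₀` and g0's current — the identification is the S1∕S6 junction); the seven letters are HYPOTHESES; nothing of [15]'s analysis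
asserted; `stub_prop8StepCoP13` ∕ K0⁷ NOT closed; N07 NOT discharged; counts unmoved (28∕28 · 5∕27); one finite 𝕋⁴ programme at fixed ε — R4 closes the
conditional finite-𝕋⁴ rung `BalabanLadder.UV` only, never the summit; the YM mass gap (Clay) is NOT proved by any of this; nothing continuum ∕ ℝ⁴ ∕ OS.
No `sorry`, no `def`, no `instance`, no `notation`.

References: [15] (27) p.282, (45)–(47) p.285, (55) p.286, (63) p.287, (66) p.287, (73) p.289, (80) p.290, (87)–(90) p.291, p.292, Prop. 4 (97)–(98) pp.292–293,
Prop. 6 p.295, (157)–(158) p.302.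
-/

set_option autoImplicit false

noncomputable section

namespace Summit.QuantumFields.YangMills.Theorems.K0Stub1SectFMultiplierFormAnalytic

/-! ## §1  (88) over `ℂ` with a bilinear pairing, and its (63)-certificate through displayed transposes -/

section Calculus

variable {E F : Type*} [NormedAddCommGroup E] [NormedSpace ℂ E] [NormedAddCommGroup F] [NormedSpace ℂ F]
variable (B : F →L[ℂ] F →L[ℂ] ℂ) (BE : E →L[ℂ] E →L[ℂ] ℂ) (Q : E →L[ℂ] F) (M : F →L[ℂ] F) (H : F →L[ℂ] E) (Dm : E → F)

/-- ★ **(88) OVER `ℂ`**: for a symmetric continuous bilinear pairing `B` on the block data, a `B`-symmetric `M` (print's `(QGQ*)⁻¹ − a`), a continuous linear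
`Q` and a map `D` with derivative `𝔇` at `A′`, the function `A ↦ ½B(D A, M D A) − B(QA, M D A)` — the `H`-part of (157) in multiplier form (brick 6
`normSq_dcE_chart_expand`) — has derivative `δ ↦ B(M(DA′ − QA′), 𝔇δ) − B(M DA′, Qδ)` at `A′`: print's four terms of (88), no derivative of `A′` in them.
[cite: Balaban1985Variational, (88) p.291, (63) p.287] -/
theorem hasFDerivAt_multiplierFormC (hB : ∀ a b, B a b = B b a) (hM : ∀ a b, B (M a) b = B a (M b)) {A' : E} {𝔇 : E →L[ℂ] F}
    (hD : HasFDerivAt Dm 𝔇 A') :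
    HasFDerivAt (fun A => 2⁻¹ * B (Dm A) (M (Dm A)) - B (Q A) (M (Dm A)))
      ((B (M (Dm A' - Q A'))).comp 𝔇 - (B (M (Dm A'))).comp Q) A' := by
  have hMD : HasFDerivAt (fun A => M (Dm A)) (M.comp 𝔇) A' := M.hasFDerivAt.comp A' hD
  have h1 : HasFDerivAt (fun A => B (Dm A) (M (Dm A))) _ A' := B.hasFDerivAt_of_bilinear hD hMD
  have h2 : HasFDerivAt (fun A => B (Q A) (M (Dm A))) _ A' := B.hasFDerivAt_of_bilinear Q.hasFDerivAt hMD
  refine ((h1.const_mul (2⁻¹ : ℂ)).sub h2).congr_fderiv ?_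
  ext δ
  have e1 : B (Dm A') (M (𝔇 δ)) = B (M (Dm A')) (𝔇 δ) := by rw [hB, hM, hB]
  have e2 : B (𝔇 δ) (M (Dm A')) = B (M (Dm A')) (𝔇 δ) := by rw [hB]
  have e3 : B (Q A') (M (𝔇 δ)) = B (M (Q A')) (𝔇 δ) := by rw [hB, hM, hB]
  have e4 : B (Q δ) (M (Dm A')) = B (M (Dm A')) (Q δ) := by rw [hB]
  simp only [sub_apply, smul_apply, add_apply, ContinuousLinearMap.comp_apply, ContinuousLinearMap.compL_apply,
    ContinuousLinearMap.precompR_apply, ContinuousLinearMap.precompL_apply, smul_eq_mul, map_sub]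
  rw [e1, e2, e3, e4]
  ring

/-- ★ **THE (63)∕(27) CERTIFICATE OF THE `H`-GROUPS**: with the transposes `Qt` of `Q` and `Dt` of `𝔇(A′)` for the pairings (`BE(Qt X, δ) = B(X, Qδ)`,
`BE(Dt X, δ) = B(X, 𝔇δ)` — print's `Q*`, `𝔇*(A′)` of (88)), the derivative of §1 IS `δ ↦ BE(W_H(A′), δ)` with `W_H(A′) = Dt(M(DA′ − QA′)) − Qt(M DA′)`.
[cite: Balaban1985Variational, (88) p.291, (63) p.287, (66) p.287] -/
theorem hasFDerivAt_multiplierFormC_pair (hB : ∀ a b, B a b = B b a) (hM : ∀ a b, B (M a) b = B a (M b)) {A' : E} {𝔇 : E →L[ℂ] F}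
    (hD : HasFDerivAt Dm 𝔇 A') (Qt Dt : F →L[ℂ] E) (hQt : ∀ X δ, BE (Qt X) δ = B X (Q δ)) (hDt : ∀ X δ, BE (Dt X) δ = B X (𝔇 δ)) :
    HasFDerivAt (fun A => 2⁻¹ * B (Dm A) (M (Dm A)) - B (Q A) (M (Dm A)))
      (BE (Dt (M (Dm A' - Q A')) - Qt (M (Dm A')))) A' := by
  refine (hasFDerivAt_multiplierFormC B Q M Dm hB hM hD).congr_fderiv ?_
  ext δ
  simp only [sub_apply, ContinuousLinearMap.comp_apply, map_sub, hQt, hDt]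

/-! ## §2  The chart (47), the composed V₀-group and the sum, over `ℂ` -/

/-- `T′(A′) = 1 − H𝔇(A′)` for `T A = A − H(D A)` (47), over `ℂ`. [cite: Balaban1985Variational, (47) p.285, (63) p.287] -/
theorem hasFDerivAt_chart47C {A' : E} {𝔇 : E →L[ℂ] F} (hD : HasFDerivAt Dm 𝔇 A') :
    HasFDerivAt (fun A => A - H (Dm A)) (ContinuousLinearMap.id ℂ E - H.comp 𝔇) A' :=
  (hasFDerivAt_id A').sub (H.hasFDerivAt.comp A' hD)

/-- ★ **THE COMPOSED V₀-GROUP OVER `ℂ`** (p. 291 (90), p. 292): if `Φ₀` has derivative `BE(g₀, ·)` at `TA′` (print: `g₀ = ((δ∕δA)V₀)(A′ − HD(A′))`, g0's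
current), `Ht` is the transpose of `H` (`B(Ht Z, X)`-free form: `BE(Z, H X) = B (Ht Z) X`) and `Dt` that of `𝔇(A′)`, then `Φ₀ ∘ T` has derivative
`BE(g₀ − Dt(Ht g₀), ·)` at `A′` — print's `(1 − 𝔇*(A′)H*)·g₀`. [cite: Balaban1985Variational, (90) p.291, p.292, (47) p.285] -/
theorem hasFDerivAt_comp_chart47C_pair (Φ₀ : E → ℂ) {A' : E} {𝔇 : E →L[ℂ] F} (hD : HasFDerivAt Dm 𝔇 A') {g₀ : E}
    (hΦ : HasFDerivAt Φ₀ (BE g₀) (A' - H (Dm A'))) (Ht : E →L[ℂ] F) (hHt : ∀ Z X, BE Z (H X) = B (Ht Z) X)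
    (Dt : F →L[ℂ] E) (hDt : ∀ X δ, BE (Dt X) δ = B X (𝔇 δ)) :
    HasFDerivAt (fun A => Φ₀ (A - H (Dm A))) (BE (g₀ - Dt (Ht g₀))) A' := by
  refine (hΦ.comp A' (hasFDerivAt_chart47C H Dm hD)).congr_fderiv ?_
  ext δ
  simp only [ContinuousLinearMap.comp_apply, sub_apply, ContinuousLinearMap.id_apply, map_sub, hHt, hDt]

/-- ★★ **SECT. F's `W = (δ∕δA′)V` OVER `ℂ`, CERTIFIED AGAINST THE PAIRING**: the non-quadratic part of (157) in multiplier form,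
`V(A) = ½B(D A, M D A) − B(QA, M D A) + Φ₀(A − H(D A))`, has derivative `BE(W(A′), ·)` at `A′` with
`W(A′) = [Dt(M(DA′ − QA′)) − Qt(M DA′)] + [g₀ − Dt(Ht g₀)]` — (88) + (90)–(96) — i.e. `⟨W(A′), δ⟩ = (d∕dt)V(A′ + tδ)|₀` for every direction: `W` IS
`(δ∕δA′)V` in the sense of (63)∕(84). [cite: Balaban1985Variational, (80) p.290, (84) p.290, (88)–(90) p.291, (157)–(158) p.302] -/
theorem hasFDerivAt_sectF_VC_pair (hB : ∀ a b, B a b = B b a) (hM : ∀ a b, B (M a) b = B a (M b)) (Φ₀ : E → ℂ) {A' : E}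
    {𝔇 : E →L[ℂ] F} (hD : HasFDerivAt Dm 𝔇 A') {g₀ : E} (hΦ : HasFDerivAt Φ₀ (BE g₀) (A' - H (Dm A')))
    (Qt Dt : F →L[ℂ] E) (hQt : ∀ X δ, BE (Qt X) δ = B X (Q δ)) (hDt : ∀ X δ, BE (Dt X) δ = B X (𝔇 δ))
    (Ht : E →L[ℂ] F) (hHt : ∀ Z X, BE Z (H X) = B (Ht Z) X) :
    HasFDerivAt (fun A => 2⁻¹ * B (Dm A) (M (Dm A)) - B (Q A) (M (Dm A)) + Φ₀ (A - H (Dm A)))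
      (BE ((Dt (M (Dm A' - Q A')) - Qt (M (Dm A'))) + (g₀ - Dt (Ht g₀)))) A' := by
  rw [map_add]
  exact (hasFDerivAt_multiplierFormC_pair B BE Q M Dm hB hM hD Qt Dt hQt hDt).add
    (hasFDerivAt_comp_chart47C_pair B BE H Dm Φ₀ hD hΦ Ht hHt Dt hDt)

/-- **FROM A (63)-CERTIFICATE ALONG LINES TO THE FRÉCHET FORM**: if `Φ` is `ℂ`-differentiable at `X` and its derivative along every line through `X` is
`BE(g, δ)` — the shape in which this lineage certifies currents, e.g. g0's `exists_W_V0_flat`: «`bondPair (W Y) δ = (d∕dt)V₀(Y + tδ)|₀`» — then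
`DΦ(X) = BE(g, ·)`: the hypothesis `hΦ` of `hasFDerivAt_comp_chart47C_pair` ∕ `hasFDerivAt_sectF_VC_pair` in the form the V₀-current of record supplies it.
[cite: Balaban1985Variational, (63) p.287, (84) p.290] -/
theorem hasFDerivAt_of_line_certificate (Φ : E → ℂ) {X : E} (hΦ : DifferentiableAt ℂ Φ X) (g : E)
    (h : ∀ δ : E, HasDerivAt (fun t : ℂ => Φ (X + t • δ)) (BE g δ) 0) : HasFDerivAt Φ (BE g) X := by
  have hF := hΦ.hasFDerivAt
  suffices e : fderiv ℂ Φ X = BE g by rw [← e]; exact hF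
  ext δ
  have e0 : X + (0 : ℂ) • δ = X := by rw [zero_smul, add_zero]
  have hF' : HasFDerivAt Φ (fderiv ℂ Φ X) (X + (0 : ℂ) • δ) := by rw [e0]; exact hF
  have hl : HasDerivAt (fun t : ℂ => X + t • δ) δ 0 := by
    simpa using ((hasDerivAt_id (0 : ℂ)).smul_const δ).const_add X
  have h1 : HasDerivAt (fun t : ℂ => Φ (X + t • δ)) (fderiv ℂ Φ X δ) 0 := hF'.comp_hasDerivAt (0 : ℂ) hl
  exact h1.unique (h δ)

/-! ## §3  Holomorphy of `A′ ↦ W(A′)` (Prop. 4: «The functional derivative of V(A′) is an analytic function on this space») -/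

/-- ★ **`hWd`: `A ↦ W(A)` IS `ℂ`-DIFFERENTIABLE** on any set where `D`, the transpose family `A ↦ 𝔇(A)ᵗ` (a map into `F →L[ℂ] E`) and the composed
V₀-current `A ↦ g₀(A)` (read at the chart point) are: `W(A) = [𝔇(A)ᵗ(M(D A − QA)) − Qt(M D A)] + [g₀(A) − 𝔇(A)ᵗ(Ht g₀(A))]` is built from them by
continuous (bi)linear operations. [cite: Balaban1985Variational, Prop. 4 p.292, (98) p.293] -/
theorem differentiableOn_sectF_WC (Qt : F →L[ℂ] E) (Ht : E →L[ℂ] F) (Dt : E → (F →L[ℂ] E)) (g : E → E) {s : Set E}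
    (hDm : DifferentiableOn ℂ Dm s) (hDt : DifferentiableOn ℂ Dt s) (hg : DifferentiableOn ℂ g s) :
    DifferentiableOn ℂ (fun A => (Dt A (M (Dm A - Q A)) - Qt (M (Dm A))) + (g A - Dt A (Ht (g A)))) s := by
  have h1 : DifferentiableOn ℂ (fun A => M (Dm A - Q A)) s := M.differentiable.comp_differentiableOn (hDm.sub Q.differentiable.differentiableOn)
  have h2 : DifferentiableOn ℂ (fun A => Qt (M (Dm A))) s := (Qt.comp M).differentiable.comp_differentiableOn hDm
  have h3 : DifferentiableOn ℂ (fun A => Ht (g A)) s := Ht.differentiable.comp_differentiableOn hg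
  exact ((hDt.clm_apply h1).sub h2).add (hg.sub (hDt.clm_apply h3))

end Calculus

/-! ## §4  The pointwise (98)-slot of the whole `W(A′)` on Pi carriers, from the printed letters -/

section Slot

variable {ι β V V' : Type*} [SeminormedAddCommGroup V] [SeminormedAddCommGroup V']

/-- ★ **THE POINTWISE (98)-SLOT OF `W(A′)` FROM THE LETTERS** (p. 291: «Applying the inequalities (3.132) from [5], (55), (73) … O(1)ε₃²(Lʲη)⁻³»; p. 292:
the V₀-groups «O(1)|∇A′||A′|» ∕ «O(1)ε₃²(ε₁ + ε₃)»), in the route `UnitScaleTilt`'s currency (fine fields `ι → V`, block data `β → V′`, pointwise weights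
`w₃, wB ≥ 0`, `wB′`): with `X₁ := M(DA′ − QA′)`, `X₂ := M DA′` and the current `g₀` at the chart point, IF (3.132) `M` maps size `s` to `O₁s`, `Qt` maps size `s`
to `q₀s`, (73)ᵀ `Dt` maps size `s` to `θs`, (46)ᵀ `Ht` maps fine size `s` to block size `h₀s`, (55) `DA′` has size `C_Dr²`, `QA′` size `qr`, `g₀` size `C_Vρ²`,
THEN `w₃(b)‖W(A′)(b)‖ ≤ θO₁(C_Dr² + qr) + q₀O₁C_Dr² + (1 + θh₀)C_Vρ²` — a constant in the letters times `r²` once `ρ ≤ ℓr` (57), `θ = θ₀r` (73), `r ≤ a₃`.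
[cite: Balaban1985Variational, (97)–(98) p.293, (88)–(90) p.291, (55)–(57) p.286, (73) p.289, (46) p.285] -/
theorem sectF_WC_slot98 (M : (β → V') → (β → V')) (Q : (ι → V) → (β → V')) (Dm : (ι → V) → (β → V'))
    (Qt Dt : (β → V') → (ι → V)) (Ht : (ι → V) → (β → V')) (A' g₀ : ι → V)
    (wB wB' : β → ℝ) (w₃ : ι → ℝ) (hwB : ∀ i, 0 ≤ wB i) (hw₃ : ∀ b, 0 ≤ w₃ b) {O₁ q₀ θ CD q r CV ρ h₀ : ℝ}
    (h3132 : ∀ (X : β → V') (s : ℝ), (∀ i, wB i * ‖X i‖ ≤ s) → ∀ i, wB' i * ‖M X i‖ ≤ O₁ * s)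
    (hQt : ∀ (X : β → V') (s : ℝ), (∀ i, wB' i * ‖X i‖ ≤ s) → ∀ b, w₃ b * ‖Qt X b‖ ≤ q₀ * s)
    (h73t : ∀ (X : β → V') (s : ℝ), (∀ i, wB' i * ‖X i‖ ≤ s) → ∀ b, w₃ b * ‖Dt X b‖ ≤ θ * s)
    (h46t : ∀ (Z : ι → V) (s : ℝ), (∀ b, w₃ b * ‖Z b‖ ≤ s) → ∀ i, wB' i * ‖Ht Z i‖ ≤ h₀ * s)
    (h55 : ∀ i, wB i * ‖Dm A' i‖ ≤ CD * r ^ 2) (hQ : ∀ i, wB i * ‖Q A' i‖ ≤ q * r) (hg : ∀ b, w₃ b * ‖g₀ b‖ ≤ CV * ρ ^ 2) :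
    ∀ b, w₃ b * ‖((Dt (M (Dm A' - Q A')) - Qt (M (Dm A'))) + (g₀ - Dt (Ht g₀))) b‖
      ≤ θ * (O₁ * (CD * r ^ 2 + q * r)) + q₀ * (O₁ * (CD * r ^ 2)) + (1 + θ * h₀) * (CV * ρ ^ 2) := by
  intro b
  have hX₁ : ∀ i, wB i * ‖(Dm A' - Q A') i‖ ≤ CD * r ^ 2 + q * r := fun i => by
    rw [Pi.sub_apply]
    calc wB i * ‖Dm A' i - Q A' i‖ ≤ wB i * (‖Dm A' i‖ + ‖Q A' i‖) := mul_le_mul_of_nonneg_left (norm_sub_le _ _) (hwB i)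
      _ = wB i * ‖Dm A' i‖ + wB i * ‖Q A' i‖ := mul_add _ _ _
      _ ≤ CD * r ^ 2 + q * r := add_le_add (h55 i) (hQ i)
  have hT₁ := h73t _ _ (h3132 _ _ hX₁) b
  have hT₂ := hQt _ _ (h3132 _ _ h55) b
  have hT₃ := h73t _ _ (h46t g₀ _ hg) b
  have hH : w₃ b * ‖(Dt (M (Dm A' - Q A')) - Qt (M (Dm A'))) b‖ ≤ θ * (O₁ * (CD * r ^ 2 + q * r)) + q₀ * (O₁ * (CD * r ^ 2)) := by
    rw [Pi.sub_apply]
    calc w₃ b * ‖Dt (M (Dm A' - Q A')) b - Qt (M (Dm A')) b‖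
        ≤ w₃ b * (‖Dt (M (Dm A' - Q A')) b‖ + ‖Qt (M (Dm A')) b‖) := mul_le_mul_of_nonneg_left (norm_sub_le _ _) (hw₃ b)
      _ ≤ _ := by rw [mul_add]; exact add_le_add hT₁ hT₂
  have hV : w₃ b * ‖(g₀ - Dt (Ht g₀)) b‖ ≤ (1 + θ * h₀) * (CV * ρ ^ 2) := by
    rw [Pi.sub_apply]
    calc w₃ b * ‖g₀ b - Dt (Ht g₀) b‖ ≤ w₃ b * (‖g₀ b‖ + ‖Dt (Ht g₀) b‖) := mul_le_mul_of_nonneg_left (norm_sub_le _ _) (hw₃ b)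
      _ ≤ CV * ρ ^ 2 + θ * (h₀ * (CV * ρ ^ 2)) := by rw [mul_add]; exact add_le_add (hg b) hT₃
      _ = (1 + θ * h₀) * (CV * ρ ^ 2) := by ring
  rw [Pi.add_apply]
  calc w₃ b * ‖(Dt (M (Dm A' - Q A')) - Qt (M (Dm A'))) b + (g₀ - Dt (Ht g₀)) b‖
      ≤ w₃ b * (‖(Dt (M (Dm A' - Q A')) - Qt (M (Dm A'))) b‖ + ‖(g₀ - Dt (Ht g₀)) b‖) :=
        mul_le_mul_of_nonneg_left (norm_add_le _ _) (hw₃ b)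
    _ ≤ _ := by rw [mul_add]; exact add_le_add hH hV

end Slot

end Summit.QuantumFields.YangMills.Theorems.K0Stub1SectFMultiplierFormAnalytic

end
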